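import Summits.BirchSwinnertonDyer.BirchSwinnertonDyer.Theorems.EisensteinPrimesH2BookkeepingUnramifiedOutside
import Literature.NumberTheory.EllipticCurves.IwasawaSelmer
import Literature.NumberTheory.GaloisRepresentations.GlobalTriangulineSpace
import HarnessLib

/-!
# The `H²` bookkeeping over a `ℤ_p`-extension `K_∞ = K̄^{ker κ}` (cell `bsd-eis`, seat `bsd-line-x1-p1-w4` gen 4; crux 2
# `GoodLatticeBDPValue` stmt-BirchSwinnertonDyer-19032, line `halves`, V21 road S4 — specialisation file (E))

HONEST FRAMING (cell `bsd-eis`, run/shared/lean/pub/bsd-eis/): Galois-cohomology bookkeeping (no definition, no named fact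
INTRODUCED — `GaloisCohomology.groupCdLE_two_galoisGroupUnramifiedOutside K` (Harari Cor. 17.14 / NSW (8.3.18), typed PUB) is a
HYPOTHESIS —, no `sorry`, no `Theses` import); nothing about any curve is asserted; BSD / IMC2 / KY Thm. 1.4.1 are proved for NO
curve. Helper `--supports stmt-BirchSwinnertonDyer-19032`; closes no registered stub.

## What

File (C) (`…H2BookkeepingUnramifiedOutside`, p647958) proves the `hH2` hypothesis of the LEAD's mid-level composition
`ResidualIndexAssembly.zpCorank_datumStrictSelmer_add_eq` for any CLOSED `H ⊴ Γ_K` containing the ramification subgroup `N_Σ`,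
`Σ = S₀ ∪ {w ∣ p}`. Here the crux's situation `H = ker κ` for a `ℤ_p`-extension `κ` of a totally complex `K`:
* §1 `ramificationSubgroup_le_kerSubgroup` (`N_Σ ≤ ker κ`: a `ℤ_p`-extension is unramified outside `p`, tree
  `ZpExtension.inertia_le_kerSubgroup_holds`, Washington Prop. 13.2); `eq_of_descended` (two descents of one discrete `Γ_K`-module to
  `G_{K,Σ}` COINCIDE — so the weak-Leopoldt hypothesis may be supplied for any descended model); `not_isReal_of_isTotallyComplex`.
* §2 `natCard_H2bookkeeping_unramifiedOutside_kerSubgroup` — **`hH2` for `H = κ.kerSubgroup`** from the residual/Kummer data, the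
  descended `A_k` with weak Leopoldt `H²(K_Σ/K_∞, A_k) = 0` in the spelling `Subsingleton ((ρA_k.restrict (galoisGroupAboveSubtype Σ
  κ.kerSubgroup)).H 2)` (the currency of `…AcTwistDeformationShapiroH`, w2 gen 4), and `cd_p(G_{K,Σ}) ≤ 2` [PUB].

References: [KellerYin2024] §1.4; [Washington1997] Prop. 13.2; [NeukirchSchmidtWingberg2008] VIII §3, (8.3.18); [Harari2020] Cor. 17.14.
-/

set_option autoImplicit false
set_option linter.dupNamespace false -- the summit namespace `…BirchSwinnertonDyer.BirchSwinnertonDyer.Theorems` (Sub = Summit, D-0017) trips it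

noncomputable section

namespace Summit.BirchSwinnertonDyer.BirchSwinnertonDyer.Theorems.UnramifiedInflation

open CategoryTheory Function NumberField IsDedekindDomain Field Topology ContinuousCohomology
open Literature.NumberTheory.EllipticCurves Literature.NumberTheory.EllipticCurves.GreenbergSelmer
  Literature.NumberTheory.EllipticCurves.GreenbergVatsal2000 Literature.NumberTheory.GaloisRepresentations
  Literature.NumberTheory.IwasawaTheory.Greenberg2006

variable {K : Type} [Field K] [NumberField K]

/-! ## §1 The ramification subgroup and `ker κ`; uniqueness of descent; no real places -/

/-- **`N_Σ ≤ ker κ`**: a `ℤ_p`-extension is unramified outside `p`, so for `Σ ⊇ {w ∣ p}` the ramification subgroup outside `Σ`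
fixes `K_∞` (inertia at `v ∤ p` lies in `ker κ`, `ZpExtension.inertia_le_kerSubgroup_holds`; `ker κ` is closed and normal).
[cite: Washington1997, Prop. 13.2] [cite: NeukirchSchmidtWingberg2008, VIII §3] -/
theorem ramificationSubgroup_le_kerSubgroup {p : ℕ} [Fact p.Prime] (κ : ZpExtension K p) {S : Set (HeightOneSpectrum (𝓞 K))}
    (hS : ∀ v : HeightOneSpectrum (𝓞 K), ((p : ℕ) : 𝓞 K) ∈ v.asIdeal → v ∈ S) :
    ramificationSubgroup K S ≤ κ.kerSubgroup := by
  refine Subgroup.topologicalClosure_minimal _ ?_ κ.isClosed_kerSubgroup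
  refine Subgroup.normalClosure_le_normal fun σ hσ ↦ ?_
  rw [mem_inertiaOutside_iff] at hσ
  obtain ⟨v, hv, 𝔓, h𝔓, hσ⟩ := hσ
  have hpv : ((p : ℕ) : 𝓞 K) ∉ v.asIdeal := fun h ↦ hv (hS v h)
  exact ZpExtension.inertia_le_kerSubgroup_holds K p κ hpv h𝔓 hσ

omit [NumberField K] in
/-- **Uniqueness of descent**: two continuous representations of `G_{K,Σ}` on the same discrete `Γ_K`-module both inducing the given
`Γ_K`-action coincide (`Γ_K → G_{K,Σ}` is onto). Hence a weak-Leopoldt hypothesis stated for one descended model serves for any other.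
[cite: NeukirchSchmidtWingberg2008, VIII §3] -/
theorem eq_of_descended {S : Set (HeightOneSpectrum (𝓞 K))} {M : Type} [AddCommGroup M] [DistribMulAction (absoluteGaloisGroup K) M]
    [TopologicalSpace M] (ρ ρ' : ContinuousRep (GaloisGroupUnramifiedOutside K S) ℤ M)
    (hρ : ∀ (σ : absoluteGaloisGroup K) (m : M), ρ (toUnramifiedQuot K S σ) m = σ • m)
    (hρ' : ∀ (σ : absoluteGaloisGroup K) (m : M), ρ' (toUnramifiedQuot K S σ) m = σ • m) : ρ = ρ' := by
  refine ContinuousRep.ext fun g ↦ ?_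
  obtain ⟨σ, rfl⟩ := toUnramifiedQuot_surjective K S g
  ext m
  rw [hρ, hρ']

omit [NumberField K] in
/-- A totally complex field has no real place, so the parity condition of Harari Cor. 17.14 is vacuous. [folklore] -/
theorem ne_two_of_isTotallyComplex [IsTotallyComplex K] (p : ℕ) : (∃ w : InfinitePlace K, w.IsReal) → p ≠ 2 := by
  rintro ⟨w, hw⟩
  exact absurd (IsTotallyComplex.isComplex w) (InfinitePlace.not_isComplex_iff_isReal.mpr hw)

/-! ## §2 `hH2` over `K_∞ = K̄^{ker κ}` -/

section Main

variable {p : ℕ} [Fact p.Prime] (κ : ZpExtension K p) (S₀ : Set (HeightOneSpectrum (𝓞 K)))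
variable {N₁ : Type} [AddCommGroup N₁] [DistribMulAction (absoluteGaloisGroup K) N₁] [TopologicalSpace N₁] [DiscreteTopology N₁]
variable {N₂ : Type} [AddCommGroup N₂] [DistribMulAction (absoluteGaloisGroup K) N₂] [TopologicalSpace N₂] [DiscreteTopology N₂]
variable {N₃ : Type} [AddCommGroup N₃] [DistribMulAction (absoluteGaloisGroup K) N₃] [TopologicalSpace N₃] [DiscreteTopology N₃]
variable {A₁ : Type} [AddCommGroup A₁] [DistribMulAction (absoluteGaloisGroup K) A₁] [TopologicalSpace A₁] [DiscreteTopology A₁]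
variable {A₂ : Type} [AddCommGroup A₂] [DistribMulAction (absoluteGaloisGroup K) A₂] [TopologicalSpace A₂] [DiscreteTopology A₂]
variable {A₃ : Type} [AddCommGroup A₃] [DistribMulAction (absoluteGaloisGroup K) A₃] [TopologicalSpace A₃] [DiscreteTopology A₃]

/-- **The `H²` bookkeeping `hH2` over a `ℤ_p`-extension** `K_∞ = K̄^{ker κ}` of a totally complex `K` (e.g. imaginary quadratic,
`κ` anticyclotomic), `Σ = S₀ ∪ {w ∣ p}`: from the residual exact sequence, the Kummer embeddings, the three modules `A_k` descended
to `G_{K,Σ}` with **weak Leopoldt** `H²(K_Σ/K_∞, A_k) = 0` (`Subsingleton ((ρA_k.restrict (galoisGroupAboveSubtype Σ κ.kerSubgroup)).H 2)`)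
and **`cd_p(G_{K,Σ}) ≤ 2`** (typed PUB fact, hypothesis) — the `hH2` hypothesis of
`ResidualIndexAssembly.zpCorank_datumStrictSelmer_add_eq` at `H = κ.kerSubgroup`, verbatim.
[cite: KellerYin2024, §1.4 (proof of Thm. 1.4.1 (iii))] [cite: Harari2020, Cor. 17.14 (p. 295)] [cite: Washington1997, Prop. 13.2] -/
theorem natCard_H2bookkeeping_unramifiedOutside_kerSubgroup [IsTotallyComplex K]
    (i : N₁ →+ N₂) (π : N₂ →+ N₃)
    (hi : ∀ (g : absoluteGaloisGroup K) (a : N₁), i (g • a) = g • i a)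
    (hπ : ∀ (g : absoluteGaloisGroup K) (b : N₂), π (g • b) = g • π b)
    (hiinj : Injective i) (hπsurj : Surjective π) (hexact : ∀ b : N₂, π b = 0 → ∃ a : N₁, i a = b)
    (hπi : ∀ a : N₁, π (i a) = 0)
    (j₁ : N₁ →+ A₁) (j₂ : N₂ →+ A₂) (j₃ : N₃ →+ A₃)
    (hj₁ : ∀ (g : absoluteGaloisGroup K) (a : N₁), j₁ (g • a) = g • j₁ a)
    (hj₂ : ∀ (g : absoluteGaloisGroup K) (a : N₂), j₂ (g • a) = g • j₂ a)
    (hj₃ : ∀ (g : absoluteGaloisGroup K) (a : N₃), j₃ (g • a) = g • j₃ a)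
    (hj₁inj : Injective j₁) (hj₂inj : Injective j₂) (hj₃inj : Injective j₃)
    (hr₁ : ∀ x : A₁, x ∈ j₁.range ↔ p • x = 0) (hr₂ : ∀ x : A₂, x ∈ j₂.range ↔ p • x = 0)
    (hr₃ : ∀ x : A₃, x ∈ j₃.range ↔ p • x = 0)
    (hd₁ : ∀ x : A₁, ∃ x' : A₁, p • x' = x) (hd₂ : ∀ x : A₂, ∃ x' : A₂, p • x' = x)
    (hd₃ : ∀ x : A₃, ∃ x' : A₃, p • x' = x)
    (hcN₁ : ∀ a : N₁, Continuous fun g : absoluteGaloisGroup K ↦ g • a)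
    (hcN₂ : ∀ a : N₂, Continuous fun g : absoluteGaloisGroup K ↦ g • a)
    (hcN₃ : ∀ a : N₃, Continuous fun g : absoluteGaloisGroup K ↦ g • a)
    -- the modules `A_k` descended to `G_{K,Σ}`, with weak Leopoldt over `K_∞`
    (ρA₁ : ContinuousRep (GaloisGroupUnramifiedOutside K (S₀ ∪ {v | ((p : ℕ) : 𝓞 K) ∈ v.asIdeal})) ℤ A₁)
    (ρA₂ : ContinuousRep (GaloisGroupUnramifiedOutside K (S₀ ∪ {v | ((p : ℕ) : 𝓞 K) ∈ v.asIdeal})) ℤ A₂)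
    (ρA₃ : ContinuousRep (GaloisGroupUnramifiedOutside K (S₀ ∪ {v | ((p : ℕ) : 𝓞 K) ∈ v.asIdeal})) ℤ A₃)
    (hρA₁ : ∀ (σ : absoluteGaloisGroup K) (m : A₁), ρA₁ (toUnramifiedQuot K _ σ) m = σ • m)
    (hρA₂ : ∀ (σ : absoluteGaloisGroup K) (m : A₂), ρA₂ (toUnramifiedQuot K _ σ) m = σ • m)
    (hρA₃ : ∀ (σ : absoluteGaloisGroup K) (m : A₃), ρA₃ (toUnramifiedQuot K _ σ) m = σ • m)
    (hWL₁ : Subsingleton ((ρA₁.restrict (galoisGroupAboveSubtype _ κ.kerSubgroup)).H 2))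
    (hWL₂ : Subsingleton ((ρA₂.restrict (galoisGroupAboveSubtype _ κ.kerSubgroup)).H 2))
    (hWL₃ : Subsingleton ((ρA₃.restrict (galoisGroupAboveSubtype _ κ.kerSubgroup)).H 2))
    (hcd : Literature.NumberTheory.GaloisCohomology.groupCdLE_two_galoisGroupUnramifiedOutside K) :
    Nat.card (↥(unramifiedOutside κ.kerSubgroup N₃ p S₀) ⧸
        ((unramifiedOutside κ.kerSubgroup N₂ p S₀).map (resH1Hom (ContinuousMonoidHom.id κ.kerSubgroup) π
          (fun g b ↦ hπ (g : absoluteGaloisGroup K) b))).addSubgroupOf (unramifiedOutside κ.kerSubgroup N₃ p S₀)) *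
        Nat.card (ModN (unramifiedOutside κ.kerSubgroup A₂ p S₀) p) =
      Nat.card (ModN (unramifiedOutside κ.kerSubgroup A₁ p S₀) p) * Nat.card (ModN (unramifiedOutside κ.kerSubgroup A₃ p S₀) p) := by
  haveI : Subsingleton (continuousCohomology 2
      (ρA₁.restrict (galoisGroupAboveSubtype (S₀ ∪ {v | ((p : ℕ) : 𝓞 K) ∈ v.asIdeal}) κ.kerSubgroup)).toTopRep) := hWL₁
  haveI : Subsingleton (continuousCohomology 2
      (ρA₂.restrict (galoisGroupAboveSubtype (S₀ ∪ {v | ((p : ℕ) : 𝓞 K) ∈ v.asIdeal}) κ.kerSubgroup)).toTopRep) := hWL₂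
  haveI : Subsingleton (continuousCohomology 2
      (ρA₃.restrict (galoisGroupAboveSubtype (S₀ ∪ {v | ((p : ℕ) : 𝓞 K) ∈ v.asIdeal}) κ.kerSubgroup)).toTopRep) := hWL₃
  exact natCard_H2bookkeeping_unramifiedOutside_of_continuous κ.kerSubgroup p S₀ κ.isClosed_kerSubgroup
    (ramificationSubgroup_le_kerSubgroup κ fun v hv ↦ Or.inr hv) i π hi hπ hiinj hπsurj hexact hπi j₁ j₂ j₃ hj₁ hj₂ hj₃
    hj₁inj hj₂inj hj₃inj hr₁ hr₂ hr₃ hd₁ hd₂ hd₃ hcN₁ hcN₂ hcN₃ ρA₁ ρA₂ ρA₃ hρA₁ hρA₂ hρA₃ hcd (ne_two_of_isTotallyComplex p)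

end Main

end Summit.BirchSwinnertonDyer.BirchSwinnertonDyer.Theorems.UnramifiedInflation

end
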